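import Summits.AnomalousDissipation.AnomalousDissipation.Theorems.SawtoothPulseCascadeK1LocalisedCascadeKHSheetPairEnergy

/-!
# K2 lane: the energy of a bare sheet pair IS the Kelvin–Helmholtz Gram form — p4's `energy (sheetPair q₊ q₋)` BY NAME

prover ad-k1loc-p2 g10 (K2 lane), crux workfile on the dir of stmt-AnomalousDissipation-19491. Consumes the tree theorem
`…Theorems.SawtoothPulseCascade.K2PhaseBudget.sheetPair_energy_hasSum'` (p687541; Mittag-Leffler sums of `…KHLineKernelFourier`, p687087) for the
typed one-family objects of `K2TypedSlotMap.lean` / `K2ConeSketch.lean` §0 (planner p4): `LamState`, `sheetPair`, `coeff`, `energy`, and `khForm` of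
`K2ControlSketch.lean` — repeated below CHARACTER-FOR-CHARACTER (the Cruxes modules are not importable on the farm), namespace `…K2SheetPairEnergy`.
PROVED: `energy_sheetPair : energy a β (sheetPair q₊ q₋) = khForm a (−β) ![q₊, q₋] / (2π)` for `a > 0` — so the certified homogeneous block bound
`KHSheetAbsolute 8 16` (`K2StubsS1S2.lean`) and `‖P(t)‖_M ≤ 16` (p685528) bound the created/evolved sheet pair in ENERGY, with no comparison constant
(p4's convention `blockX a β = khField a (−β)`); and `energy_sheetPair_pos`: a nonzero sheet pair has positive energy.
Also for p4's bookkeeping: `hasSum_lineWeights` (`Σ_n 1/(4π²(a²+(β+n)²)) = −Σ₀(a,β)/(2π)`), i.e. the energy of the pure interior mode `n` is the single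
weight, and the weights sum to the sheet self-energy. Nothing here is K2: the forced block (creation law P1″/P3) and S3/S4 remain.
-/

open Set

set_option linter.dupNamespace false

namespace Summit.AnomalousDissipation.AnomalousDissipation.Cruxes.K1LocalisedCascade.K2SheetPairEnergy

open Literature.Analysis.FluidPDE.SawtoothCascade
open Summit.AnomalousDissipation.AnomalousDissipation.Theorems.SawtoothPulseCascade.K2PhaseBudget

noncomputable section

/-! ## Verbatim copies (p4: `K2ConeSketch.lean` §0.2–0.3 = `K2TypedSlotMap.lean` §2–3; `khForm` of `K2ControlSketch.lean` §5) -/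

/-- S-4 state of ONE line family: an interior density profile on the period `[-1/2, 1/2)` (quasi-periodic
continuation with Bloch phase `β` understood) plus finitely many vortex SHEETS `(position yᵢ ∈ [-1/2,1/2),
amplitude cᵢ)`, i.e. the transverse density `ζ₀(y) + Σᵢ cᵢ δ(y - yᵢ)` of the streamwise mode `e^{2πiax}`. -/
structure LamState where
  interior : ℝ → ℂ
  sheets : List (ℝ × ℂ)

/-- A bare sheet pair on the kink lines with amplitudes `(q₊, q₋)` and no interior content. -/
def sheetPair (qp qm : ℂ) : LamState := ⟨fun _ => 0, [((1 / 4 : ℝ), qp), (-(1 / 4 : ℝ), qm)]⟩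

/-- Transverse Fourier coefficient at `β + n`: `ζ̂(n) = ∫ ζ₀ e^{-2πi(β+n)y} dy + Σᵢ cᵢ e^{-2πi(β+n)yᵢ}`. -/
def coeff (β : ℝ) (st : LamState) (n : ℤ) : ℂ :=
  (∫ y in (-(1 / 2 : ℝ))..(1 / 2), st.interior y * Complex.exp (-(2 * Real.pi * (β + n) * y : ℝ) * Complex.I))
    + (st.sheets.map (fun p => p.2 * Complex.exp (-(2 * Real.pi * (β + n) * p.1 : ℝ) * Complex.I))).sum

/-- Kinetic energy (velocity `L²` norm squared, up to the common factor) of the state on the family `(a, β)`: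
`E = Σ_n |ζ̂(n)|² / (4π² (a² + (β + n)²))` (junk 0 if not summable; summable whenever the interior is
integrable, the coefficients being bounded and the weights `O(n⁻²)`). -/
def energy (a β : ℝ) (st : LamState) : ℝ :=
  ∑' n : ℤ, ‖coeff β st n‖ ^ 2 / (4 * Real.pi ^ 2 * (a ^ 2 + (β + n) ^ 2))

/-- Kinetic energy of the velocity induced by the sheet pair with amplitudes `q` (per cell, up to a positive
scalar): `qᴴ M q`, `M = −[[Σ₀, S],[S̄, Σ₀]]`. -/
def khForm (k β : ℝ) (q : Fin 2 → ℂ) : ℝ :=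
  -(sawSigma0 k β) * (Complex.normSq (q 0) + Complex.normSq (q 1))
    - 2 * ((starRingEnd ℂ (q 0)) * sawS k β * q 1).re

/-! ## The identity -/

/-- The coefficients of a bare sheet pair: `ζ̂(n) = q₊ e^{−2πi(β+n)/4} + q₋ e^{2πi(β+n)/4}`. -/
theorem coeff_sheetPair (β : ℝ) (qp qm : ℂ) (n : ℤ) :
    coeff β (sheetPair qp qm) n = qp * Complex.exp (-(2 * Real.pi * (β + n) * (1 / 4 : ℝ) : ℝ) * Complex.I) +
      qm * Complex.exp (-(2 * Real.pi * (β + n) * (-(1 / 4 : ℝ)) : ℝ) * Complex.I) := by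
  simp [coeff, sheetPair]

/-- **`energy a β (sheetPair q₊ q₋) = khForm a (−β) (q₊, q₋) / (2π)`** for `a > 0` (tree `sheetPair_energy_hasSum'`, p687541). -/
theorem energy_sheetPair {a : ℝ} (ha : 0 < a) (β : ℝ) (qp qm : ℂ) :
    energy a β (sheetPair qp qm) = khForm a (-β) ![qp, qm] / (2 * Real.pi) := by
  unfold energy khForm
  simp only [coeff_sheetPair, Matrix.cons_val_zero, Matrix.cons_val_one]
  exact (sheetPair_energy_hasSum' ha β qp qm).tsum_eq

/-- The energy of a sheet pair dominates `(−Σ₀(a,−β) − |S_{−β}(a)|)(|q₊|² + |q₋|²)/(2π)`, a positive multiple of `|q₊|² + |q₋|²`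
(tree `khGram_ge`, p678850): a nonzero pair has positive energy. -/
theorem energy_sheetPair_pos {a : ℝ} (ha : 0 < a) (β : ℝ) {qp qm : ℂ} (hq : qp ≠ 0 ∨ qm ≠ 0) :
    0 < energy a β (sheetPair qp qm) := by
  rw [energy_sheetPair ha]
  have h := khGram_ge ha (-β) qp qm
  have hn : 0 < Complex.normSq qp + Complex.normSq qm := by
    rcases hq with h0 | h1
    · exact add_pos_of_pos_of_nonneg (Complex.normSq_pos.2 h0) (Complex.normSq_nonneg _)
    · exact add_pos_of_nonneg_of_pos (Complex.normSq_nonneg _) (Complex.normSq_pos.2 h1)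
  unfold khForm
  simp only [Matrix.cons_val_zero, Matrix.cons_val_one]
  exact div_pos (lt_of_lt_of_le (mul_pos h.1 hn) h.2) (by positivity)

/-- For the record, in p4's weights: `Σ_n 1/(4π²(a² + (β+n)²)) = −Σ₀(a,β)/(2π)` — the energy `1/(4π²(a²+(β+n)²))` of the unit interior mode
`e^{2πi(β+n)y}` (its only nonzero coefficient is `ζ̂(n) = 1`), summed over the family, is the sheet self-energy coefficient (tree `hasSum_lineWeights`). -/
theorem tsum_weights {a : ℝ} (ha : 0 < a) (β : ℝ) :
    ∑' n : ℤ, (1 / (4 * Real.pi ^ 2 * (a ^ 2 + (β + n) ^ 2)) : ℝ) = -sawSigma0 a β / (2 * Real.pi) :=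
  (hasSum_lineWeights ha β).tsum_eq

end

end Summit.AnomalousDissipation.AnomalousDissipation.Cruxes.K1LocalisedCascade.K2SheetPairEnergy
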